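import Mathlib
import HarnessLib

/-!
# Maynard 2016, §3: the probabilistic method (PROVED)

Topic `Literature/NumberTheory/Sieve`. Everything in this file is PROVED; it is the abstract
content of §3 of J. Maynard, *Large gaps between primes*, Ann. of Math. 183 (2016):

  "Given an even `m < U/(z (log₂ x)²)` and a prime `q ∈ 𝓘_m`, we will define a probability measure
  `μ_{m,q}` on the residue classes `a (mod q)`. … independently for each prime `q ∈ 𝓘_m`, we
  randomly choose a residue class `a (mod q)` with probability `μ_{m,q}(a)`. Given a prime
  `p ∈ 𝓡_m`, … the probability that `p` is not in any of the chosen residue classes … is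
  `∏_q (1 − μ_{m,q}(p)) ≤ exp(−Σ_q μ_{m,q}(p))`. Therefore if for almost every `p ∈ 𝓡_m` … the
  expected number of `q ∈ 𝓘_m` for which the residue class `p (mod q)` is chosen is at least `t`,
  … the expected number of primes in `𝓡_m` which are not in any of the chosen residue classes is
  at most `e^{−t}|𝓡_m|`. … there must be at least one configuration of residue classes … which
  covers all but at most `ε|𝓡_m|` elements of `𝓡_m`, as required."

We formalise this for an arbitrary finite set `R` of targets, a finite set `Q` of "moduli", a
class map `cls q : P → α` (think `p ↦ p mod q`) with values in a finite support `S q`, and weights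
`μ q : α → ℝ`, nonnegative on `S q` and summing to `1` there. The random choice is replaced by the
equivalent averaging (method of conditional expectations, by induction on `Q`), so no probability
space is needed:

* `exists_le_weighted_avg` : some point is at most the `μ`-average;
* `exists_choice_card_uncovered_le` : **there is a choice `a : Q → classes` leaving at most
  `Σ_{p ∈ R} ∏_{q ∈ Q} (1 − μ_q(cls_q p))` targets uncovered**;
* `prod_one_sub_le_exp_neg_sum` : `∏_q (1 − μ_q) ≤ exp(−Σ_q μ_q)`;
* `exists_choice_card_uncovered_le_exp` : if `Σ_q μ_q(cls_q p) ≥ t` for all `p ∈ R` outside an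
  exceptional set `E`, some choice leaves at most `|E ∩ R| + e^{−t}|R|` targets uncovered.

## References

* J. Maynard, *Large gaps between primes*, Ann. of Math. (2) 183 (2016), 915–933; arXiv:1408.5110,
  §3 «The probabilistic method». [Maynard2016LargeGaps]
* N. Alon, J. Spencer, *The Probabilistic Method*, 4th ed., Wiley 2016, §16.1 (method of
  conditional expectations). [AlonSpencer2016]
-/

open Finset

namespace Literature.NumberTheory.Sieve

namespace Maynard2016

/-! ### Averaging -/

/-- **Weighted averaging**: if `μ ≥ 0` on a finite set `S` with `Σ_{c∈S} μ c = 1`, then some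
`c ∈ S` (with `μ c > 0`) has `X c ≤ Σ_{c∈S} μ c · X c`. [cite: AlonSpencer2016, §16.1] -/
theorem exists_le_weighted_avg {α : Type*} (S : Finset α) (μ X : α → ℝ)
    (hμ0 : ∀ c ∈ S, 0 ≤ μ c) (hμ1 : ∑ c ∈ S, μ c = 1) :
    ∃ c ∈ S, 0 < μ c ∧ X c ≤ ∑ c ∈ S, μ c * X c := by
  classical
  set S' := S.filter (fun c => 0 < μ c) with hS'
  have hsum' : ∑ c ∈ S', μ c = 1 := by
    rw [hS', sum_filter, ← hμ1]
    refine sum_congr rfl fun c hc => ?_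
    by_cases h : 0 < μ c
    · simp [h]
    · simp [h]; linarith [hμ0 c hc]
  have hsumX : ∑ c ∈ S', μ c * X c = ∑ c ∈ S, μ c * X c := by
    rw [hS', sum_filter]
    refine sum_congr rfl fun c hc => ?_
    by_cases h : 0 < μ c
    · simp [h]
    · have : μ c = 0 := le_antisymm (not_lt.1 h) (hμ0 c hc)
      simp [this]
  have hne : S'.Nonempty := by
    by_contra h
    rw [not_nonempty_iff_eq_empty] at h
    rw [h, sum_empty] at hsum'
    exact zero_ne_one hsum'
  set A := ∑ c ∈ S, μ c * X c with hA
  have h := exists_le_of_sum_le hne (f := fun c => μ c * X c) (g := fun c => μ c * A) (by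
    rw [hsumX, ← sum_mul, hsum', one_mul])
  obtain ⟨c, hc, hle⟩ := h
  have hc' := (mem_filter.1 hc)
  refine ⟨c, hc'.1, hc'.2, ?_⟩
  exact le_of_mul_le_mul_left (by simpa [mul_comm] using hle) hc'.2

/-! ### The covering choice -/

/-- **Maynard §3, derandomised**: for moduli `Q`, class maps `cls q : P → α` with values in the
finite supports `S q` on the targets `R`, and weights `μ q ≥ 0` on `S q` summing to `1`, there is a
choice of one class `a q` per modulus such that the number of targets `p ∈ R` lying in none of the
chosen classes is at most `Σ_{p∈R} ∏_{q∈Q} (1 − μ_q(cls_q p))` (the expected number of uncovered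
targets under independent random choices with laws `μ_q`). [cite: Maynard2016LargeGaps, §3] -/
theorem exists_choice_card_uncovered_le {ι α P : Type*} [DecidableEq ι] [DecidableEq α]
    (Q : Finset ι) (S : ι → Finset α) (μ : ι → α → ℝ)
    (hμ0 : ∀ q ∈ Q, ∀ c ∈ S q, 0 ≤ μ q c) (hμ1 : ∀ q ∈ Q, ∑ c ∈ S q, μ q c = 1)
    (R : Finset P) (cls : ι → P → α) (hcls : ∀ q ∈ Q, ∀ p ∈ R, cls q p ∈ S q) (a₀ : ι → α) :
    ∃ a : ι → α,
      (((R.filter (fun p => ∀ q ∈ Q, cls q p ≠ a q)).card : ℝ)) ≤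
        ∑ p ∈ R, ∏ q ∈ Q, (1 - μ q (cls q p)) := by
  classical
  induction Q using Finset.induction_on generalizing R with
  | empty =>
    refine ⟨a₀, ?_⟩
    simp
  | @insert q₀ Q hq₀ ih =>
    -- weights after the remaining moduli
    set w : P → ℝ := fun p => ∏ q ∈ Q, (1 - μ q (cls q p)) with hw
    have hw0 : ∀ p ∈ R, 0 ≤ w p := by
      intro p hp
      refine prod_nonneg fun q hq => ?_
      have h1 : μ q (cls q p) ≤ 1 := by
        have hq' : q ∈ insert q₀ Q := mem_insert_of_mem hq
        rw [← hμ1 q hq']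
        exact single_le_sum (fun c hc => hμ0 q hq' c hc) (hcls q hq' p hp)
      linarith
    have hq₀m : q₀ ∈ insert q₀ Q := mem_insert_self q₀ Q
    -- average over the class `c` chosen for `q₀`
    obtain ⟨c, hcS, -, hcle⟩ := exists_le_weighted_avg (S q₀) (μ q₀)
      (fun c => ∑ p ∈ R.filter (fun p => cls q₀ p ≠ c), w p) (hμ0 q₀ hq₀m) (hμ1 q₀ hq₀m)
    -- the average equals `Σ_p (1 − μ_{q₀}(cls p)) w p`
    have havg : ∑ c ∈ S q₀, μ q₀ c * ∑ p ∈ R.filter (fun p => cls q₀ p ≠ c), w p =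
        ∑ p ∈ R, (1 - μ q₀ (cls q₀ p)) * w p := by
      simp_rw [sum_filter, mul_sum]
      rw [sum_comm]
      refine sum_congr rfl fun p hp => ?_
      have h1 : ∑ c ∈ S q₀, μ q₀ c * (if cls q₀ p ≠ c then w p else 0) =
          ∑ c ∈ S q₀, (if c = cls q₀ p then 0 else μ q₀ c * w p) := by
        refine sum_congr rfl fun c _ => ?_
        by_cases h : c = cls q₀ p
        · simp [h]
        · simp [h, Ne.symm h]
      rw [h1, sum_ite, sum_const_zero, zero_add, Finset.filter_ne', sum_erase_eq_sub (hcls q₀ hq₀m p hp),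
        ← sum_mul, hμ1 q₀ hq₀m]
      ring
    -- induction hypothesis on the targets not covered by the class `c` of `q₀`
    have hsubQ : ∀ q ∈ Q, q ∈ insert q₀ Q := fun q hq => mem_insert_of_mem hq
    obtain ⟨a, ha⟩ := ih (fun q hq => hμ0 q (hsubQ q hq)) (fun q hq => hμ1 q (hsubQ q hq))
      (R.filter (fun p => cls q₀ p ≠ c)) (fun q hq p hp => hcls q (hsubQ q hq) p (mem_filter.1 hp).1)
    refine ⟨Function.update a q₀ c, ?_⟩
    -- uncovered by `insert q₀ Q` = (not in class `c` of `q₀`) ∧ uncovered by `Q` under `a`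
    have hset : (R.filter (fun p => ∀ q ∈ insert q₀ Q, cls q p ≠ Function.update a q₀ c q)) =
        (R.filter (fun p => cls q₀ p ≠ c)).filter (fun p => ∀ q ∈ Q, cls q p ≠ a q) := by
      rw [filter_filter]
      refine filter_congr fun p _ => ?_
      rw [forall_mem_insert, Function.update_self]
      refine and_congr Iff.rfl (forall₂_congr fun q hq => ?_)
      rw [Function.update_of_ne (ne_of_mem_of_not_mem hq hq₀)]
    rw [hset]
    refine ha.trans ?_
    calc ∑ p ∈ R.filter (fun p => cls q₀ p ≠ c), ∏ q ∈ Q, (1 - μ q (cls q p))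
        = ∑ p ∈ R.filter (fun p => cls q₀ p ≠ c), w p := rfl
      _ ≤ ∑ c ∈ S q₀, μ q₀ c * ∑ p ∈ R.filter (fun p => cls q₀ p ≠ c), w p := hcle
      _ = ∑ p ∈ R, (1 - μ q₀ (cls q₀ p)) * w p := havg
      _ = ∑ p ∈ R, ∏ q ∈ insert q₀ Q, (1 - μ q (cls q p)) := by
          refine sum_congr rfl fun p _ => ?_
          rw [prod_insert hq₀]

/-! ### `∏ (1 − μ) ≤ exp(−Σ μ)` and the counting form -/

/-- `∏_{q∈Q} (1 − u_q) ≤ exp(−Σ_{q∈Q} u_q)` for `0 ≤ u_q ≤ 1`. [cite: Maynard2016LargeGaps, §3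
(first display)] -/
theorem prod_one_sub_le_exp_neg_sum {ι : Type*} (Q : Finset ι) (u : ι → ℝ)
    (hu1 : ∀ q ∈ Q, u q ≤ 1) :
    ∏ q ∈ Q, (1 - u q) ≤ Real.exp (-∑ q ∈ Q, u q) := by
  rw [← sum_neg_distrib, Real.exp_sum]
  exact prod_le_prod (fun q hq => by linarith [hu1 q hq]) fun q _ => Real.one_sub_le_exp_neg _

/-- **Maynard §3, counting form**: if every target `p ∈ R` outside an exceptional set `E` has
expected multiplicity `Σ_{q∈Q} μ_q(cls_q p) ≥ t`, then some choice of classes leaves at most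
`|R ∩ E| + e^{−t} |R|` targets uncovered. [cite: Maynard2016LargeGaps, §3] -/
theorem exists_choice_card_uncovered_le_exp {ι α P : Type*} [DecidableEq ι] [DecidableEq α]
    [DecidableEq P] (Q : Finset ι) (S : ι → Finset α) (μ : ι → α → ℝ)
    (hμ0 : ∀ q ∈ Q, ∀ c ∈ S q, 0 ≤ μ q c) (hμ1 : ∀ q ∈ Q, ∑ c ∈ S q, μ q c = 1)
    (R E : Finset P) (cls : ι → P → α) (hcls : ∀ q ∈ Q, ∀ p ∈ R, cls q p ∈ S q) (a₀ : ι → α)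
    (t : ℝ) (ht : ∀ p ∈ R, p ∉ E → t ≤ ∑ q ∈ Q, μ q (cls q p)) :
    ∃ a : ι → α,
      (((R.filter (fun p => ∀ q ∈ Q, cls q p ≠ a q)).card : ℝ)) ≤
        ((R ∩ E).card : ℝ) + Real.exp (-t) * R.card := by
  classical
  obtain ⟨a, ha⟩ := exists_choice_card_uncovered_le Q S μ hμ0 hμ1 R cls hcls a₀
  refine ⟨a, ha.trans ?_⟩
  have hle1 : ∀ q ∈ Q, ∀ p ∈ R, μ q (cls q p) ≤ 1 := by
    intro q hq p hp
    rw [← hμ1 q hq]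
    exact single_le_sum (fun c hc => hμ0 q hq c hc) (hcls q hq p hp)
  have hterm : ∀ p ∈ R, ∏ q ∈ Q, (1 - μ q (cls q p)) ≤
      (if p ∈ E then 1 else 0) + Real.exp (-t) := by
    intro p hp
    have hprod1 : ∏ q ∈ Q, (1 - μ q (cls q p)) ≤ 1 := by
      refine prod_le_one (fun q hq => by linarith [hle1 q hq p hp]) fun q hq => ?_
      linarith [hμ0 q hq _ (hcls q hq p hp)]
    by_cases hpE : p ∈ E
    · simp only [hpE, if_true]
      linarith [Real.exp_pos (-t)]
    · simp only [hpE, if_false, zero_add]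
      refine (prod_one_sub_le_exp_neg_sum Q (fun q => μ q (cls q p)) fun q hq => hle1 q hq p hp).trans ?_
      exact Real.exp_le_exp.2 (by linarith [ht p hp hpE])
  calc ∑ p ∈ R, ∏ q ∈ Q, (1 - μ q (cls q p))
      ≤ ∑ p ∈ R, ((if p ∈ E then (1 : ℝ) else 0) + Real.exp (-t)) := sum_le_sum hterm
    _ = ((R ∩ E).card : ℝ) + Real.exp (-t) * R.card := by
        rw [sum_add_distrib, sum_const, nsmul_eq_mul, ← sum_filter, sum_const, nsmul_eq_mul,
          mul_one, filter_mem_eq_inter, mul_comm]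

end Maynard2016

end Literature.NumberTheory.Sieve
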